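import Summits.CriticalPhenomena.Ising3D.TaylorRegionSplitEven
import Mathlib.Tactic.Linarith
import Mathlib.Tactic.Positivity
import Mathlib.Tactic.Ring
import HarnessLib

/-!
# The odd cone from SPLIT Booleans (sizes, tail, per-row containment, per-piece positivity) and the all-split capstone
(cell `pub-ising3x`, seat recog-1 gen 12; gate (g2) — certificate-file shape, odd sector; twin of `TaylorRegionSplitEven`)

HONEST FRAMING: lottery ticket; floor = tightest certified 3D Ising CFT bounds; no exact-solution
claim without a proof. Island framing: certified exclusion region at stated derivative order and
assumptions; not a determination of the 3D Ising critical exponents beyond that.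

The landed odd-cone check `OddConeRegionDataH.checkP` is ONE Boolean (five `(P, D)` tables, the `(E, θ)` tail, and
for every integer `j ≤ J₁` four `posOn` rows on COMPUTED rows). For a certificate file every conjunct becomes its own
hypothesis: `OddConeRegionDataH.sizesOK`, the tail `d.tail.check` (unchanged, one declaration), `rowLitOK L j`
(containment of the four computed combination rows `M⁺, M⁻, R⁺, R⁻` of row `j` in producer literals
`L[j] = (LM⁺, LM⁻, LR⁺, LR⁻)`, one declaration per `j` or per chunk) and `pieceOK L K j k` (the four `posOn`s on the
`k`-th of `K` uniform pieces of `[max(E₀, j) − cc, E₁ − cc]` on the literals, one declaration each).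
**`oddCone_of_split`** assembles them into the `odd_cone` field shape; turnkey `oddCone_of_certSplit` (root atoms as
`OddConeRegionCertH.atomsOK`), glue `TaylorTable.oddCone_of_oddCertSplit`, and the ALL-SPLIT capstone
**`TaylorTable.boxExcluded_of_taylorTable_dec_of_split`** (`T.check`, `T.checkEncl`, the even split Booleans of
`TaylorRegionSplitEven`, the odd split Booleans ⇒ `BoxExcluded T.box`). Elementary. [folklore]
-/

namespace Summit.CriticalPhenomena.Ising3D

open Finset Set
open Literature.Analysis.ValidatedNumerics Literature.Analysis.ValidatedNumerics.PolyMP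
open Literature.Analysis.ValidatedNumerics.NumericsMP (MI)
open Literature.MathematicalPhysics.QuantumFieldTheory.ConformalBootstrap3D

/-! ### The split Booleans, odd sector -/

namespace OddConeRegionDataH

/-- Sizes and parameter sanity. [folklore] -/
def sizesOK (d : OddConeRegionDataH) : Bool :=
  decide (0 < d.S) && decide (0 < d.κ₀Q) && decide (0 < d.E0) && decide (d.E1 ≤ (d.J1 : ℚ) + 1) &&
  kernelSizeOK d.S (d.cQ 2) (-1) d.sbI d.ccQ d.l d.N && kernelSizeOK d.S (d.cQ 3) (-1) d.sσI d.ccQ d.l d.N &&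
  kernelSizeOK d.S (d.cQ 4) 1 d.sσI d.ccQ d.l d.N && kernelSizeOK d.S d.ψQ 0 (MI.ofInt d.S 0) d.ccQ d.lψ d.N &&
  kernelSizeOK d.S d.ψQ 0 d.stI d.ccQ d.lψ d.N

/-- The default literal row (empty). [folklore] -/
def noLits : IPoly × IPoly × IPoly × IPoly := ([], [], [], [])

/-- Containment of row `j`'s four computed combination rows `(M⁺, M⁻, R⁺, R⁻)` in the literals `L[j]`. [folklore] -/
def rowLitOK (d : OddConeRegionDataH) (L : List (IPoly × IPoly × IPoly × IPoly)) (j : ℕ) : Bool :=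
  subsetI (d.PM 1 j) (L.getD j noLits).1 && subsetI (d.PM (-1) j) (L.getD j noLits).2.1 &&
    subsetI (d.PR 1 j) (L.getD j noLits).2.2.1 && subsetI (d.PR (-1) j) (L.getD j noLits).2.2.2

/-- Left end of the `k`-th of `K` uniform pieces of row `j`'s interval `[max(E₀,j) − cc, E₁ − cc]`. [folklore] -/
def pieceLo (d : OddConeRegionDataH) (K j k : ℕ) : ℚ :=
  (max d.E0 (j : ℚ) - d.ccQ) + (k : ℚ) * ((d.E1 - max d.E0 (j : ℚ)) / (K : ℚ))

/-- ONE piece of row `j` on the literals: the four rows positive by `posOn` to depth `dPj` inside the piece; vacuously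
true when the row's interval is empty. [folklore] -/
def pieceOK (d : OddConeRegionDataH) (L : List (IPoly × IPoly × IPoly × IPoly)) (K j k : ℕ) : Bool :=
  decide (d.E1 < max d.E0 (j : ℚ)) ||
  (posOn d.S d.dPj (L.getD j noLits).1 (d.pieceLo K j k) (d.pieceLo K j (k + 1)) &&
    posOn d.S d.dPj (L.getD j noLits).2.1 (d.pieceLo K j k) (d.pieceLo K j (k + 1)) &&
    posOn d.S d.dPj (L.getD j noLits).2.2.1 (d.pieceLo K j k) (d.pieceLo K j (k + 1)) &&
    posOn d.S d.dPj (L.getD j noLits).2.2.2 (d.pieceLo K j k) (d.pieceLo K j (k + 1)))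

end OddConeRegionDataH

/-- **The odd cone from the split Booleans** (statement of `oddCone_of_oddConeRegionCheckHP`). [folklore] -/
theorem oddCone_of_split (d : OddConeRegionDataH) (L : List (IPoly × IPoly × IPoly × IPoly)) {K : ℕ} (hK : 0 < K)
    (hl : d.l.Nodup) (hlψ : d.lψ.Nodup) (Q : Set (ℝ × ℝ))
    (hQ : ∀ p ∈ Q, MI.mem d.S p.1 d.sσI ∧ MI.mem d.S ((p.1 + p.2) / 2) d.sbI ∧ MI.mem d.S (p.1 - p.2) d.stI ∧
      MI.mem d.S ((1 / 2 : ℝ) ^ (p.1 + p.2)) d.K1 ∧ MI.mem d.S ((1 / 2 : ℝ) ^ (p.2 - p.1)) d.K2 ∧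
      MI.mem d.S ((1 / 2 : ℝ) ^ (-(2 * p.2))) d.K3)
    (hs : d.sizesOK = true) (ht : d.tail.check = true) (hr : ∀ j : ℕ, j < d.J1 + 1 → d.rowLitOK L j = true)
    (hpc : ∀ j k : ℕ, j < d.J1 + 1 → k < K → d.pieceOK L K j k = true) :
    ∀ p ∈ Q, ∀ (E : ℝ) (j : ℕ), ((d.E0 : ℚ) : ℝ) ≤ E → (j : ℝ) ≤ E →
      OddConeAt (taylorCrossing (1 / 2) (1 / 2) d.l.toFinset fun i ab => (d.cQ i ab : ℝ))
        (∑ ab ∈ d.lψ.toFinset, (d.ψQ ab : ℝ) • taylorCoeffAt (1 / 2) (1 / 2) ab) (d.κ₀Q : ℝ) p.1 p.2 E j := by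
  simp only [OddConeRegionDataH.sizesOK, Bool.and_eq_true, decide_eq_true_eq] at hs
  obtain ⟨⟨⟨⟨⟨⟨⟨⟨hS, hκ₀⟩, hE0⟩, hJ1⟩, hN3⟩, hN4⟩, hN5⟩, hNψ0⟩, hNψt⟩ := hs
  intro p hp E j hE hj
  by_cases hE1 : ((d.E1 : ℚ) : ℝ) ≤ E
  · have htl := oddCone_of_oddConeRegionCheckEJ d.tail hl hlψ Q hQ ht p hp E j
    simp only [OddConeRegionDataH.tail, sub_add_cancel] at htl
    exact htl hE1 hj
  · obtain ⟨hsσ, hsb, hst, hK1, hK2, hK3⟩ := hQ p hp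
    have hElt : E < d.E1 := lt_of_not_ge hE1
    have hjJ : j < d.J1 + 1 := by
      have h1 : (j : ℝ) < (d.J1 : ℝ) + 1 := by
        have : ((d.E1 : ℚ) : ℝ) ≤ (d.J1 : ℝ) + 1 := by exact_mod_cast hJ1
        linarith
      exact_mod_cast h1
    have hrow := hr j hjJ
    simp only [OddConeRegionDataH.rowLitOK, Bool.and_eq_true] at hrow
    obtain ⟨⟨⟨sM1, sM2⟩, sR1⟩, sR2⟩ := hrow
    have h0mem : MI.mem d.S (0 : ℝ) (MI.ofInt d.S 0) := by simpa using MI.mem_ofInt d.S 0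
    have p3 := pmem_qRowOfTableI (pmem2_kernelPDLI_of_mem hS hsb (d.cQ 2) (-1) d.ccQ d.l) d.N j
    have p4 := pmem_qRowOfTableI (pmem2_kernelPDLI_of_mem hS hsσ (d.cQ 3) (-1) d.ccQ d.l) d.N j
    have p5 := pmem_qRowOfTableI (pmem2_kernelPDLI_of_mem hS hsσ (d.cQ 4) 1 d.ccQ d.l) d.N j
    have pψ0 := pmem_qRowOfTableI (pmem2_kernelPDLI_of_mem hS h0mem d.ψQ 0 d.ccQ d.lψ) d.N j
    have pψt := pmem_qRowOfTableI (pmem2_kernelPDLI_of_mem hS hst d.ψQ 0 d.ccQ d.lψ) d.N j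
    have pM : ∀ ε : ℤ, PMem d.S (addR (qRowOfTable (kernelPDL (fun ab => (d.ψQ ab : ℝ)) d.lψ 0 ((0 : ℚ) : ℝ) (d.ccQ : ℝ)) d.N j)
        (smulR (-(ε : ℝ)) (smulR ((1 / 2 : ℝ) ^ (p.1 + p.2))
          (qRowOfTable (kernelPDL (fun ab => (d.cQ 2 ab : ℝ)) d.l ((p.1 + p.2) / 2) ((-1 : ℚ) : ℝ) (d.ccQ : ℝ)) d.N j))))
        (d.PM ε j) := fun ε =>
      pmem_addI pψ0 (pmem_smulQI _ (by push_cast; ring) (pmem_smulI hS hK1 p3))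
    have pR : ∀ ε : ℤ, PMem d.S
        (addR (addR (qRowOfTable (kernelPDL (fun ab => (d.cQ 3 ab : ℝ)) d.l p.1 ((-1 : ℚ) : ℝ) (d.ccQ : ℝ)) d.N j)
            (smulR ((-1 : ℤ) : ℝ) (qRowOfTable (kernelPDL (fun ab => (d.cQ 4 ab : ℝ)) d.l p.1 ((1 : ℚ) : ℝ) (d.ccQ : ℝ)) d.N j)))
          (addR (smulR (-(ε : ℝ) * ((d.κ₀Q : ℝ) / 2)) (smulR ((1 / 2 : ℝ) ^ (p.2 - p.1))
              (qRowOfTable (kernelPDL (fun ab => (d.cQ 2 ab : ℝ)) d.l ((p.1 + p.2) / 2) ((-1 : ℚ) : ℝ) (d.ccQ : ℝ)) d.N j)))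
            (smulR (-((d.κ₀Q : ℝ)⁻¹ / 2)) (smulR ((1 / 2 : ℝ) ^ (-(2 * p.2)))
              (qRowOfTable (kernelPDL (fun ab => (d.ψQ ab : ℝ)) d.lψ (p.1 - p.2) ((0 : ℚ) : ℝ) (d.ccQ : ℝ)) d.N j)))))
        (d.PR ε j) := fun ε =>
      pmem_addI (pmem_addI p4 (pmem_smulIntI (-1 : ℤ) p5))
        (pmem_addI (pmem_smulQI _ (by push_cast; ring) (pmem_smulI hS hK2 p3))
          (pmem_smulQI _ (by push_cast; ring) (pmem_smulI hS hK3 pψt)))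
    -- the literals enclose the same real rows
    have qM1 := pmem_of_subsetI (pM 1) sM1
    have qM2 := pmem_of_subsetI (pM (-1)) sM2
    have qR1 := pmem_of_subsetI (pR 1) sR1
    have qR2 := pmem_of_subsetI (pR (-1)) sR2
    -- locate the piece of P = E − cc
    have hmE2 : max (d.E0 : ℝ) (j : ℝ) ≤ E := max_le hE hj
    have hmE : ((max d.E0 (j : ℚ) : ℚ) : ℝ) ≤ E := by push_cast; exact hmE2
    have hm1 : max d.E0 (j : ℚ) ≤ d.E1 := by
      have : ((max d.E0 (j : ℚ) : ℚ) : ℝ) ≤ ((d.E1 : ℚ) : ℝ) := hmE.trans hElt.le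
      exact_mod_cast this
    have hw : 0 ≤ (d.E1 - max d.E0 (j : ℚ)) / (K : ℚ) := div_nonneg (by linarith) (by positivity)
    have hmono : ∀ k : ℕ, d.pieceLo K j k ≤ d.pieceLo K j (k + 1) := fun k => by
      unfold OddConeRegionDataH.pieceLo; push_cast; nlinarith
    have e0 : d.pieceLo K j 0 = max d.E0 (j : ℚ) - d.ccQ := by unfold OddConeRegionDataH.pieceLo; simp
    have hKq : (K : ℚ) ≠ 0 := by exact_mod_cast hK.ne'
    have eK : d.pieceLo K j K = d.E1 - d.ccQ := by
      unfold OddConeRegionDataH.pieceLo; field_simp; ring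
    have hn1 : K - 1 + 1 = K := Nat.sub_add_cancel hK
    obtain ⟨k, hk, hk1, hk2⟩ := exists_mem_gridCell (fun k : ℕ => ((d.pieceLo K j k : ℚ) : ℝ)) (K - 1)
      (Δ := E - d.ccQ) (by show ((d.pieceLo K j 0 : ℚ) : ℝ) ≤ E - d.ccQ; rw [e0]; push_cast; linarith [hmE2])
      (by show E - d.ccQ ≤ ((d.pieceLo K j (K - 1 + 1) : ℚ) : ℝ); rw [hn1, eK]; push_cast; linarith)
    have hkK : k < K := by omega
    have hpiece := hpc j k hjJ hkK
    simp only [OddConeRegionDataH.pieceOK, Bool.or_eq_true, Bool.and_eq_true, decide_eq_true_eq] at hpiece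
    rcases hpiece with hvac | ⟨⟨⟨rM1, rM2⟩, rR1⟩, rR2⟩
    · exfalso
      have : ((d.E1 : ℚ) : ℝ) < ((max d.E0 (j : ℚ) : ℚ) : ℝ) := by exact_mod_cast hvac
      linarith
    have vM1 := posOn_sound hS rM1 (hmono k) qM1 hk1 hk2
    have vM2 := posOn_sound hS rM2 (hmono k) qM2 hk1 hk2
    have vR1 := posOn_sound hS rR1 (hmono k) qR1 hk1 hk2
    have vR2 := posOn_sound hS rR2 (hmono k) qR2 hk1 hk2
    simp only [evalR_addR, evalR_smulR, Int.cast_one, Int.cast_neg] at vM1 vM2 vR1 vR2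
    have e3 := qSum_eq_evalR_qRowOfTable hS (d.cQ 2) (-1) hsb d.ccQ hl hN3 E j
    have e4 := qSum_eq_evalR_qRowOfTable hS (d.cQ 3) (-1) hsσ d.ccQ hl hN4 E j
    have e5 := qSum_eq_evalR_qRowOfTable hS (d.cQ 4) 1 hsσ d.ccQ hl hN5 E j
    have eψ0 := qSum_eq_evalR_qRowOfTable hS d.ψQ 0 h0mem d.ccQ hlψ hNψ0 E j
    have eψt := qSum_eq_evalR_qRowOfTable hS d.ψQ 0 hst d.ccQ hlψ hNψt E j
    rw [← e3, ← eψ0] at vM1 vM2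
    rw [← e3, ← e4, ← e5, ← eψt] at vR1 vR2
    simp only [Rat.cast_neg, Rat.cast_one, Rat.cast_zero] at vM1 vM2 vR1 vR2
    have hκ₁ : 0 ≤ (1 / 2 : ℝ) ^ (p.1 + p.2) := (Real.rpow_pos_of_pos (by norm_num) _).le
    have hκ₂ : 0 ≤ (1 / 2 : ℝ) ^ (p.2 - p.1) := (Real.rpow_pos_of_pos (by norm_num) _).le
    have hκ₀R : (0 : ℝ) < (d.κ₀Q : ℝ) := by exact_mod_cast hκ₀
    refine oddConeAt_half_of_qCone _ _ _ _ _ p.1 p.2 E j hj ?_ ?_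
    · rw [← abs_of_nonneg hκ₁, ← abs_mul, abs_le]
      constructor <;> linarith
    · have hc : 0 ≤ (d.κ₀Q : ℝ) / 2 * (1 / 2 : ℝ) ^ (p.2 - p.1) := by positivity
      rcases le_total 0 (qSum (fun ab => (d.cQ 2 ab : ℝ)) d.l.toFinset ((p.1 + p.2) / 2) (-1) E j) with h3 | h3
      · rw [abs_of_nonneg h3]; linarith
      · rw [abs_of_nonpos h3]
        have := mul_nonneg hc (neg_nonneg.mpr h3)
        nlinarith

/-! ### Turnkey, `TaylorTable` glue, and the all-split capstone -/

namespace OddConeRegionCertH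

/-- The list-and-root-atom part of `OddConeRegionCertH.checkP` (everything except the data check). [folklore] -/
def atomsOK (c : OddConeRegionCertH) : Bool :=
  decide (0 < c.S) && decide c.l.Nodup && decide c.lψ.Nodup &&
  c.k1lo.ok c.S 1 2 (c.box.σlo + c.box.εlo) && c.k1hi.ok c.S 1 2 (c.box.σhi + c.box.εhi) &&
  c.k2lo.ok c.S 1 2 (c.box.εlo - c.box.σhi) && c.k2hi.ok c.S 1 2 (c.box.εhi - c.box.σlo) &&
  c.k3lo.ok c.S 2 1 (2 * c.box.εlo) && c.k3hi.ok c.S 2 1 (2 * c.box.εhi)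

end OddConeRegionCertH

/-- [folklore] -/
theorem oddCone_of_certSplit (c : OddConeRegionCertH) (L : List (IPoly × IPoly × IPoly × IPoly)) {K : ℕ} (hK : 0 < K)
    (ha : c.atomsOK = true) (hs : c.data.sizesOK = true) (ht : c.data.tail.check = true)
    (hr : ∀ j : ℕ, j < c.data.J1 + 1 → c.data.rowLitOK L j = true)
    (hp : ∀ j k : ℕ, j < c.data.J1 + 1 → k < K → c.data.pieceOK L K j k = true) :
    ∀ p ∈ Icc (c.box.σlo : ℝ) c.box.σhi ×ˢ Icc (c.box.εlo : ℝ) c.box.εhi, ∀ (E : ℝ) (j : ℕ),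
      ((c.E0 : ℚ) : ℝ) ≤ E → (j : ℝ) ≤ E →
      OddConeAt (taylorCrossing (1 / 2) (1 / 2) c.l.toFinset fun i ab => (c.cQ i ab : ℝ))
        (∑ ab ∈ c.lψ.toFinset, (c.ψQ ab : ℝ) • taylorCoeffAt (1 / 2) (1 / 2) ab) (c.κ₀Q : ℝ) p.1 p.2 E j := by
  simp only [OddConeRegionCertH.atomsOK, Bool.and_eq_true, decide_eq_true_eq] at ha
  obtain ⟨⟨⟨⟨⟨⟨⟨⟨hS, hl⟩, hlψ⟩, hk1lo⟩, hk1hi⟩, hk2lo⟩, hk2hi⟩, hk3lo⟩, hk3hi⟩ := ha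
  refine oddCone_of_split c.data L hK hl hlψ _ (fun p hp => ?_) hs ht hr hp
  obtain ⟨h1, h2, h3, h4⟩ := BoxQ.bounds (B := c.box) hp
  refine ⟨mem_enclQ _ h1 h2, mem_enclQ _ (by push_cast; linarith) (by push_cast; linarith),
    mem_enclQ _ (by push_cast; linarith) (by push_cast; linarith), ?_, ?_, ?_⟩
  · exact mem_half_rpow_span hS hk1lo hk1hi (by push_cast; linarith) (by push_cast; linarith)
  · exact mem_half_rpow_span hS hk2lo hk2hi (by push_cast; linarith) (by push_cast; linarith)
  · exact mem_half_rpow_neg_span hS hk3lo hk3hi (y := 2 * p.2) (by push_cast; linarith) (by push_cast; linarith)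

namespace TaylorTable

variable (T : TaylorTable)

/-- **The table's odd cone from the split Booleans.** [folklore] -/
theorem oddCone_of_oddCertSplit (π : OddConeParamsH) (L : List (IPoly × IPoly × IPoly × IPoly)) {K : ℕ}
    (hK : 0 < K) (ha : (T.oddCertH π).atomsOK = true) (hs : (T.oddCertH π).data.sizesOK = true)
    (ht : (T.oddCertH π).data.tail.check = true)
    (hr : ∀ j : ℕ, j < (T.oddCertH π).data.J1 + 1 → (T.oddCertH π).data.rowLitOK L j = true)
    (hp : ∀ j k : ℕ, j < (T.oddCertH π).data.J1 + 1 → k < K → (T.oddCertH π).data.pieceOK L K j k = true) :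
    T.OddCone :=
  oddCone_of_certSplit (T.oddCertH π) L hK ha hs ht hr hp

/-- **All-split capstone**: table check, enclosure check, the even split Booleans (`TaylorRegionSplitEven`), the odd
split Booleans ⇒ the box is excluded. Every hypothesis after `h`, `he` is a Boolean on rational data meant to be ONE
`decide +kernel` declaration of a certificate file (the `∀` hypotheses: one declaration per index). [folklore] -/
theorem boxExcluded_of_taylorTable_dec_of_split (h : T.check = true) (he : T.checkEncl = true)
    (πE : EvenRegionParamsH) (LT : IPoly2 × IPoly2 × IPoly2) (LE : List (IPoly × IPoly × IPoly)) {KE : ℕ}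
    (hKE : 0 < KE) (hlE : (T.evenCertH πE).l.Nodup) (hsE : (T.evenCertH πE).data.sizesOK = true)
    (hLT : (T.evenCertH πE).data.tailLitOK LT = true) (hX : (T.evenCertH πE).data.tailXOKL LT = true)
    (hY : (T.evenCertH πE).data.tailYOKL LT = true)
    (hD : ∀ k : ℕ, k < (T.evenCertH πE).data.prmD.nθ → (T.evenCertH πE).data.tailDCellOKL LT k = true)
    (hrE : ∀ j : ℕ, j < (T.evenCertH πE).data.J1 + 1 → (T.evenCertH πE).data.rowLitOK LE j = true)
    (hpE : ∀ j k : ℕ, j < (T.evenCertH πE).data.J1 + 1 → k < KE → (T.evenCertH πE).data.pieceOK LE KE j k = true)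
    (πO : OddConeParamsH) (LO : List (IPoly × IPoly × IPoly × IPoly)) {KO : ℕ} (hKO : 0 < KO)
    (haO : (T.oddCertH πO).atomsOK = true) (hsO : (T.oddCertH πO).data.sizesOK = true)
    (htO : (T.oddCertH πO).data.tail.check = true)
    (hrO : ∀ j : ℕ, j < (T.oddCertH πO).data.J1 + 1 → (T.oddCertH πO).data.rowLitOK LO j = true)
    (hpO : ∀ j k : ℕ, j < (T.oddCertH πO).data.J1 + 1 → k < KO → (T.oddCertH πO).data.pieceOK LO KO j k = true) :
    BoxExcluded T.box :=
  T.boxExcluded_of_taylorTable_dec h he (T.evenRegion_of_evenCertSplit πE LT LE hKE hlE hsE hLT hX hY hD hrE hpE)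
    (T.oddCone_of_oddCertSplit πO LO hKO haO hsO htO hrO hpO)

end TaylorTable

/-! ### Fixture: the toy odd certificate through the split Booleans (`K = 2`; literals = the computed rows) -/

/-- The toy's literal rows: the computed combination rows themselves (containment is then decided by evaluation). [folklore] -/
def toyOddLits : List (IPoly × IPoly × IPoly × IPoly) :=
  (List.range (toyOddConeRegionCertH.data.J1 + 1)).map fun j =>
    (toyOddConeRegionCertH.data.PM 1 j, toyOddConeRegionCertH.data.PM (-1) j,
      toyOddConeRegionCertH.data.PR 1 j, toyOddConeRegionCertH.data.PR (-1) j)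

/-- [folklore] -/
theorem toyOdd_atomsOK : toyOddConeRegionCertH.atomsOK = true := by decide +kernel

/-- [folklore] -/
theorem toyOdd_sizesOK : toyOddConeRegionCertH.data.sizesOK = true := by decide +kernel

/-- [folklore] -/
theorem toyOdd_tail : toyOddConeRegionCertH.data.tail.check = true := by decide +kernel

/-- [folklore] -/
theorem toyOdd_rows : ∀ j : ℕ, j < toyOddConeRegionCertH.data.J1 + 1 →
    toyOddConeRegionCertH.data.rowLitOK toyOddLits j = true := by
  have hJ : toyOddConeRegionCertH.data.J1 + 1 = 9 := by decide
  intro j hj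
  rw [hJ] at hj
  interval_cases j <;> decide +kernel

/-- [folklore] -/
theorem toyOdd_pieces : ∀ j k : ℕ, j < toyOddConeRegionCertH.data.J1 + 1 → k < 2 →
    toyOddConeRegionCertH.data.pieceOK toyOddLits 2 j k = true := by
  have hJ : toyOddConeRegionCertH.data.J1 + 1 = 9 := by decide
  intro j k hj hk
  rw [hJ] at hj
  interval_cases j <;> interval_cases k <;> decide +kernel

/-- The toy's odd cone through the split route (statement shape of `oddCone_of_certHP`; an `example`). [folklore] -/
example : ∀ p ∈ Icc (toyOddConeRegionCertH.box.σlo : ℝ) toyOddConeRegionCertH.box.σhi ×ˢ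
      Icc (toyOddConeRegionCertH.box.εlo : ℝ) toyOddConeRegionCertH.box.εhi, ∀ (E : ℝ) (j : ℕ),
      ((toyOddConeRegionCertH.E0 : ℚ) : ℝ) ≤ E → (j : ℝ) ≤ E →
      OddConeAt (taylorCrossing (1 / 2) (1 / 2) toyOddConeRegionCertH.l.toFinset fun i ab => (toyOddConeRegionCertH.cQ i ab : ℝ))
        (∑ ab ∈ toyOddConeRegionCertH.lψ.toFinset, (toyOddConeRegionCertH.ψQ ab : ℝ) • taylorCoeffAt (1 / 2) (1 / 2) ab)
        (toyOddConeRegionCertH.κ₀Q : ℝ) p.1 p.2 E j :=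
  oddCone_of_certSplit toyOddConeRegionCertH toyOddLits (K := 2) (by norm_num) toyOdd_atomsOK toyOdd_sizesOK toyOdd_tail
    toyOdd_rows toyOdd_pieces

end Summit.CriticalPhenomena.Ising3D
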